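import Literature.Probability.RandomPlanarGeometry.SAWLoopErasureKestenRenewalGreenTableHigh
import Literature.Probability.RandomPlanarGeometry.SAWLoopErasureKestenRenewalSharp
import Literature.Probability.RandomPlanarGeometry.SAWMemorySixAllDimensions
import Literature.Probability.LatticeModels.SRWReturnFourier
import Literature.Probability.FitznerVanDerHofstad2017.SrwLawBridges
import HarnessLib

/-!
# The Green function of simple random walk at the origin by Chernoff and Gauss, and the Kesten envelope `|μ(ℤ^d) − (2d − 1 − 1/(2d))| ≤ 20/d²` for every `d ≥ 2`

Topic `Literature/Probability/RandomPlanarGeometry`; the analytic ("all large `d`") companion of the certified table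
`SAWLoopErasureKestenRenewalGreenTable(High).lean` (`d = 3, …, 21`).  Both feed the plug-in form of the
Hara–Slade–Sokal `(0,1)` renewal bound `two_mul_div_renewal_le_connectiveConstant_of_le (hd : 3 ≤ d) :
G_d ≤ B → 2d/(2 − 1/B) ≤ μ(ℤ^d)` of `SAWLoopErasureKestenRenewal.lean`, where `G_d = srwI d 1 0 0 = Σ_m p_{2m}(0)` is the
expected number of visits of simple random walk to its starting point (HSS93's `C₀(0,0;1/2d)`).

## Content

* §1 (private) `I₀(u) ≤ e^{u²/4}` (termwise on the power series) and the **Chernoff point bound**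
  `srwLaw_two_mul_zero_le_chernoff (hd : 1 ≤ d) (m) : p_{2m}(0) ≤ (2m)!·e^m/(4dm)^m` — the tree's Lemma P
  `LongRangePhi4.srwLaw_mul_coshPartialSum_le` (`p_{2m}(0)·Σ_{j≤m} t^{2j}/(2j)! ≤ I₀(t/d)^d`) at `t² = 4dm`, keeping the single
  term `t^{2m}/(2m)!`.  (Relative to the exact `p_{2m}(0) ~ (2m)!/(4^m m! d^m)` the loss is the Stirling factor `e^m m!/m^m ≈ √(2πm)`.)
* §2 the **Gaussian far tail** `tsum_far_le (hd : 20 ≤ d) : Σ_{m > d²} p_{2m}(0) ≤ 800/5^d` from the tree's Fourier heat-kernel bound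
  `SRW.prob_le_inv_sqrt_pow : p_n(0) ≤ C_d n^{-d/2}`, `C_d = (2π)^{-d}(1 + 2^d)(dπ³/2)^{d/2}` (`SRWReturnFourier.lean`, bridged by
  `prob_eq_srwLaw`): for `n ≥ 2d²` the ratio `√(dπ³/2)/(2π√n)` is `≤ 1/10`, and the remaining `n^{-2}` is summed by telescoping
  (`SRW.hasSum_telescope`).
* §3 the rational Chernoff table `chernoffCoeff m ≥ (2m)!·e^m/(4m)^m` (`3 ≤ m ≤ 12`, `e ≤ 2.718281829`), the **head**
  `Σ_{4≤m<12} p_{2m}(0) ≤ (Σ c̄_m/22^{m−4})/d⁴` and the **block** `Σ_{12≤m≤d²} p_{2m}(0) ≤ (d² − 11)·p_{24}(0) ≤ (c̄₁₂/22⁶)/d⁴`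
  (`srwLaw_two_mul_zero_antitone`), all for `d ≥ 22`.
* §4 **`srwI_one_le_sixth_add (hd : 22 ≤ d) : G_d ≤ 1 + 1/(2d) + (3/(4d²) − 3/(8d³)) + p₆(0) + 51/d⁴`** — exact `p₀ = 1`,
  `p₂(0) = 1/(2d)`, `p₄(0) = 3/(4d²) − 3/(8d³)` (`SAWLoopErasureKestenRenewalSharp.lean`) and the three pieces above
  (`50.38… ≤ 51`).  The exact `p₆(0) = 15/(8d³) − 45/(16d⁴) + 5/(4d⁵)` of `SAWLoopErasureKestenRenewalThird.lean` turns this into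
  `G_d ≤ 1 + 1/(2d) + 3/(4d²) + 3/(2d³) + 49/d⁴` and the floor `2d − 1 − 1/(2d) − 1/d² − 94/d³ ≤ μ(ℤ^d)`, `d ≥ 22` (left to a
  def-free heir of that module; not restated here).
* §5 the unconditional version with the Chernoff value `p₆(0) ≤ 8.37/d³`:
  **`srwI_one_le_chernoff₃ (hd : 22 ≤ d) : G_d ≤ 1 + 1/(2d) + 3/(4d²) + 8/d³ + 51/d⁴`**,
  **`kesten_renewal_chernoff₃ (hd : 22 ≤ d) : 2d − 1 − 1/(2d) − 14/d² − 120/d³ ≤ μ(ℤ^d)`** and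
  `twoTerm_sub_twenty_div_sq_le_connectiveConstant_of_le (hd : 22 ≤ d) : 2d − 1 − 1/(2d) − 20/d² ≤ μ(ℤ^d)`.
* §6 **all dimensions**: with the certified floors `renewalFloor_le_connectiveConstant` (`3 ≤ d ≤ 21`,
  `SAWLoopErasureKestenRenewalGreenTableHigh.lean`), `connectiveConstant_pos` (`d = 2`, where the floor is negative) and the memory-six ceiling
  `connectiveConstant_lt_twoTerm (hd : 2 ≤ d) : μ(ℤ^d) < 2d − 1 − 1/(2d)` (`SAWMemorySixAllDimensions.lean`):
  **`twoTerm_sub_twenty_div_sq_le_connectiveConstant (hd : 2 ≤ d) : 2d − 1 − 1/(2d) − 20/d² ≤ μ(ℤ^d)`** and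
  **`abs_connectiveConstant_sub_twoTerm_le_twenty_div_sq (hd : 2 ≤ d) : |μ(ℤ^d) − (2d − 1 − 1/(2d))| ≤ 20/d²`** —
  the tree's threshold-free envelope `abs_connectiveConstant_sub_two_le_all` (`SAWAllDimensionsEnvelope.lean`) has `4559/d²`.

## Where it improves the tree

The threshold-free envelope constant drops from `4559` to `20`.  Lower bounds for `μ(ℤ^d)`, `22 ≤ d ≤ 52`: the tree's
`kesten_second_order_renewal_sharp₉ (5 ≤ d) : 2d − 1 − 1/(2d) − 1/d² − 9/d³ − 204704/d⁴ ≤ μ` (`…RenewalSharp.lean`) and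
`kesten_third_order_renewal_sharp₁₁ (5 ≤ d) : … − 11/(4d³) − 49/d⁴ − 2249392/d⁵ ≤ μ` (`…RenewalThird.lean`) carry Taylor-kernel
remainder constants that dominate for small `d`; here the remainder is `14/d² + 120/d³` (`d = 22`: `42.937` against `42.101` /
`42.538`; `d = 30`: `58.963` against `58.729` / `58.889`; `d = 50`: `98.9834` against `98.9568` / `98.9824`; from `d = 53` on
`sharp₁₁` is better).  HONEST SCOPE: an upper ENCLOSURE of `G_d` evaluated in HSS93's `(0,1)` bound — no new mathematics about `μ`;
the `d⁻³` coefficient `8` (true value `3/2`) is the price of not importing the exact `p₆(0)`, and the `d⁻⁴` constant `51` (the true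
remainder is `≈ 7/d⁴` at `d = 22`) is the Stirling loss of the Chernoff head.  The printed `(0,1)` values of HSS93 Table 2 are NOT
reproduced at this precision (that is the certified table's job, `d ≤ 21`).
-/

namespace Literature.Probability.RandomPlanarGeometry.SAW.Zd.LoopErasure

open Finset
open scoped Nat
open Literature.Probability.LatticeModels (besselI besselITerm besselITerm_nonneg hasSum_besselITerm
  besselI_nonneg)
open Literature.Barriers.CriticalPhenomena.LongRangePhi4 (srwLaw srwLaw_nonneg srwLaw_zero_apply
  srwLaw_mul_coshPartialSum_le besselITerm_zero_eq srwLaw_two_mul_zero_antitone)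
open Literature.Probability.FitznerVanDerHofstad2017
open Literature.Probability.LatticeModels.SRW (retConst retConst_pos prob_le_inv_sqrt_pow hasSum_telescope)

variable {d : ℕ}

namespace GreenChernoff

/-! ### §1 `I₀(u) ≤ exp(u²/4)` and the Chernoff point bound -/

/-- `I₀(u) ≤ e^{u²/4}`: termwise `(u/2)^{2k}/(k!)² ≤ (u²/4)^k/k!`. [folklore] -/
private theorem besselI_zero_le_exp_sq_div_four (u : ℝ) : besselI 0 u ≤ Real.exp (u ^ 2 / 4) := by
  have h1 := hasSum_besselITerm 0 u
  have h2 : HasSum (fun k : ℕ => (u ^ 2 / 4) ^ k / (k ! : ℝ)) (Real.exp (u ^ 2 / 4)) := by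
    rw [Real.exp_eq_exp_ℝ]
    exact NormedSpace.expSeries_div_hasSum_exp (u ^ 2 / 4)
  refine hasSum_le (fun k => ?_) h1 h2
  rw [besselITerm_zero_eq]
  have hk : (1 : ℝ) ≤ (k ! : ℝ) := by exact_mod_cast Nat.one_le_iff_ne_zero.mpr (Nat.factorial_ne_zero k)
  have hpow : (u / 2) ^ (2 * k) = (u ^ 2 / 4) ^ k := by
    rw [pow_mul]; congr 1; ring
  rw [hpow]
  exact div_le_div_of_nonneg_left (by positivity) (by positivity) (by nlinarith)

/-- **Chernoff point bound** `p_{2m}(0) ≤ (2m)!·e^m/(4dm)^m` (`d ≥ 1`): Lemma P at `t = 2√(dm)` with the single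
term `t^{2m}/(2m)!` of the cosh partial sum and `I₀(t/d)^d ≤ e^{t²/(4d)} = e^m`. [cite: HaraSladeSokal1993, Appendix A.1 pp. 28–30 and Table 4 (C₀(0,0;1/2d) = G_d, via the Bessel representation); lane certificate] -/
theorem srwLaw_two_mul_zero_le_chernoff (hd : 1 ≤ d) (m : ℕ) :
    srwLaw d (2 * m) 0 ≤ ((2 * m)! : ℝ) * Real.exp m / (4 * d * m : ℝ) ^ m := by
  rcases Nat.eq_zero_or_pos m with rfl | hm
  · simp [srwLaw_zero_apply]
  have hd0 : (0 : ℝ) < d := by exact_mod_cast hd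
  have hm0 : (0 : ℝ) < m := by exact_mod_cast hm
  set t : ℝ := Real.sqrt (4 * d * m) with ht
  have ht0 : 0 ≤ t := Real.sqrt_nonneg _
  have ht2 : t ^ 2 = 4 * d * m := Real.sq_sqrt (by positivity)
  have hP := srwLaw_mul_coshPartialSum_le hd m ht0
  have hterm : t ^ (2 * m) / ((2 * m)! : ℝ) ≤ ∑ j ∈ range (m + 1), t ^ (2 * j) / ((2 * j)! : ℝ) :=
    single_le_sum (f := fun j => t ^ (2 * j) / ((2 * j)! : ℝ)) (fun j _ => by positivity)
      (mem_range.2 (Nat.lt_succ_self m))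
  have hI : besselI 0 (t / d) ^ d ≤ Real.exp m := by
    calc besselI 0 (t / d) ^ d ≤ Real.exp ((t / d) ^ 2 / 4) ^ d :=
          pow_le_pow_left₀ (besselI_nonneg (by positivity) 0) (besselI_zero_le_exp_sq_div_four _) d
      _ = Real.exp m := by
          rw [← Real.exp_nat_mul]
          congr 1
          rw [div_pow, ht2]
          field_simp
  have hq0 : 0 ≤ srwLaw d (2 * m) 0 := srwLaw_nonneg _ _
  have hmain : srwLaw d (2 * m) 0 * (t ^ (2 * m) / ((2 * m)! : ℝ)) ≤ Real.exp m :=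
    (mul_le_mul_of_nonneg_left hterm hq0).trans (hP.trans hI)
  have htm : t ^ (2 * m) = (4 * d * m : ℝ) ^ m := by rw [pow_mul, ht2]
  rw [htm] at hmain
  have hpos : (0 : ℝ) < (4 * d * m : ℝ) ^ m := by positivity
  have hfac : (0 : ℝ) < ((2 * m)! : ℝ) := by positivity
  rw [le_div_iff₀ hpos]
  have := mul_le_mul_of_nonneg_right hmain hfac.le
  calc srwLaw d (2 * m) 0 * (4 * d * m : ℝ) ^ m
      = srwLaw d (2 * m) 0 * ((4 * d * m : ℝ) ^ m / ((2 * m)! : ℝ)) * ((2 * m)! : ℝ) := by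
        field_simp
    _ ≤ Real.exp m * ((2 * m)! : ℝ) := this
    _ = ((2 * m)! : ℝ) * Real.exp m := mul_comm _ _

/-! ### §2 The Gaussian far tail: `Σ_{m > d²} p_{2m}(0) ≤ 800/5^d` (`d ≥ 20`) -/

/-- `C_d (√n)⁻¹^d = (1 + 2^d) · (√(dπ³/2)/(2π√n))^d` (`n > 0`). [folklore] -/
private theorem retConst_mul_inv_sqrt_pow_eq {n : ℝ} (hn : 0 < n) :
    retConst d * (Real.sqrt n)⁻¹ ^ d =
      (1 + 2 ^ d) * (Real.sqrt (d * Real.pi ^ 3 / 2) / (2 * Real.pi * Real.sqrt n)) ^ d := by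
  unfold retConst
  have hπ : (0 : ℝ) < 2 * Real.pi := by positivity
  have hs : (0 : ℝ) < Real.sqrt n := Real.sqrt_pos.2 hn
  rw [div_pow, mul_pow, inv_pow]
  field_simp
  ring

/-- The Gaussian heat-kernel constant in the regime `n ≥ 2d²`, `d ≥ 20`:
`C_d (√n)⁻¹^d ≤ (1 + 2^d) (1/10)^{d−4} (dπ/(8n))²` (the ratio `r = √(dπ³/2)/(2π√n)` has `r² = dπ/(8n) ≤ 1/100`).
[folklore] -/
private theorem retConst_mul_inv_sqrt_pow_le (hd : 20 ≤ d) {n : ℝ} (hn : 2 * (d : ℝ) ^ 2 ≤ n) :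
    retConst d * (Real.sqrt n)⁻¹ ^ d ≤
      (1 + 2 ^ d) * ((1 / 10) ^ (d - 4) * (d * Real.pi / (8 * n)) ^ 2) := by
  have hd0 : (0 : ℝ) < d := by exact_mod_cast (show 0 < d by omega)
  have hd20 : (20 : ℝ) ≤ d := by exact_mod_cast hd
  have hn0 : 0 < n := lt_of_lt_of_le (by positivity) hn
  rw [retConst_mul_inv_sqrt_pow_eq hn0]
  refine mul_le_mul_of_nonneg_left ?_ (by positivity)
  set r : ℝ := Real.sqrt (d * Real.pi ^ 3 / 2) / (2 * Real.pi * Real.sqrt n) with hr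
  have hr0 : 0 ≤ r := by positivity
  have hr2 : r ^ 2 = d * Real.pi / (8 * n) := by
    rw [hr, div_pow, mul_pow, Real.sq_sqrt (by positivity), Real.sq_sqrt hn0.le]
    have hπ : (Real.pi : ℝ) ≠ 0 := Real.pi_ne_zero
    field_simp
    ring
  have hr2le : r ^ 2 ≤ (1 / 10) ^ 2 := by
    rw [hr2, div_le_iff₀ (by positivity)]
    have hπ := Real.pi_lt_d2
    nlinarith
  have hrle : r ≤ 1 / 10 := by
    have := (pow_le_pow_iff_left₀ hr0 (by norm_num : (0 : ℝ) ≤ 1 / 10) two_ne_zero).1 hr2le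
    exact this
  have hsplit : r ^ d = r ^ (d - 4) * (r ^ 2) ^ 2 := by
    rw [← pow_mul, ← pow_add]
    congr 1
    omega
  rw [hsplit, hr2]
  exact mul_le_mul_of_nonneg_right (pow_le_pow_left₀ hr0 hrle _) (by positivity)

/-- Term bound in the far tail (`d ≥ 20`, `j : ℕ`): `p_{2(j+d²+1)}(0) ≤ (1 + 2^d)(1/10)^{d−4}(dπ/16)² · (1/(j+d²) − 1/(j+d²+1))`
(Gaussian bound `prob_le_inv_sqrt_pow` and `1/k² ≤ 1/((k−1)k)`). [folklore] -/
private theorem srwLaw_far_term_le (hd : 20 ≤ d) (j : ℕ) :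
    srwLaw d (2 * (j + (d ^ 2 + 1))) 0 ≤
      (1 + 2 ^ d) * ((1 / 10) ^ (d - 4) * (d * Real.pi / 16) ^ 2) *
        (1 / ((j + d ^ 2 : ℕ) : ℝ) - 1 / ((j + d ^ 2 + 1 : ℕ) : ℝ)) := by
  have hdpos : 0 < d := by omega
  have hd0 : (0 : ℝ) < d := by exact_mod_cast hdpos
  set k : ℕ := j + (d ^ 2 + 1) with hk
  have hk1 : 1 ≤ 2 * k := by omega
  have hkR : (2 : ℝ) * (d : ℝ) ^ 2 ≤ ((2 * k : ℕ) : ℝ) := by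
    have : 2 * d ^ 2 ≤ 2 * k := by rw [hk]; nlinarith
    exact_mod_cast this
  have h1 : srwLaw d (2 * k) 0 ≤ retConst d * (Real.sqrt ((2 * k : ℕ) : ℝ))⁻¹ ^ d := by
    rw [← prob_eq_srwLaw]
    exact prob_le_inv_sqrt_pow hdpos hk1
  refine h1.trans ((retConst_mul_inv_sqrt_pow_le hd hkR).trans ?_)
  rw [mul_assoc, mul_assoc]
  refine mul_le_mul_of_nonneg_left ?_ (by positivity)
  refine mul_le_mul_of_nonneg_left ?_ (by positivity)
  -- (dπ/(8·2k))² ≤ (dπ/16)² (1/(k-1) - 1/k), with k - 1 = j + d², k = j + d² + 1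
  have hkm : ((j + d ^ 2 : ℕ) : ℝ) = (k : ℝ) - 1 := by rw [hk]; push_cast; ring
  have hkk : ((j + d ^ 2 + 1 : ℕ) : ℝ) = (k : ℝ) := by rw [hk]; push_cast; ring
  rw [hkm, hkk]
  have hk2 : (2 : ℝ) ≤ k := by
    have : 2 ≤ k := by rw [hk]; nlinarith
    exact_mod_cast this
  have hkpos : (0 : ℝ) < k := by linarith
  have hk1pos : (0 : ℝ) < (k : ℝ) - 1 := by linarith
  rw [div_sub_div _ _ hk1pos.ne' hkpos.ne', one_mul, mul_one, show (k : ℝ) - ((k : ℝ) - 1) = 1 by ring]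
  have hcast : ((2 * k : ℕ) : ℝ) = 2 * (k : ℝ) := by push_cast; ring
  rw [hcast, div_pow, div_pow, show (8 * (2 * (k : ℝ))) ^ 2 = (16 : ℝ) ^ 2 * (k : ℝ) ^ 2 by ring,
    ← div_div, div_le_iff₀ (by positivity)]
  have hnum : 0 ≤ (d * Real.pi) ^ 2 / (16 : ℝ) ^ 2 := by positivity
  have key : (1 : ℝ) ≤ 1 / (((k : ℝ) - 1) * k) * (k : ℝ) ^ 2 := by
    rw [div_mul_eq_mul_div, one_mul, le_div_iff₀ (mul_pos hk1pos hkpos)]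
    nlinarith
  calc ((d : ℝ) * Real.pi) ^ 2 / 16 ^ 2 = ((d : ℝ) * Real.pi) ^ 2 / 16 ^ 2 * 1 := by ring
    _ ≤ ((d : ℝ) * Real.pi) ^ 2 / 16 ^ 2 * (1 / (((k : ℝ) - 1) * k) * (k : ℝ) ^ 2) :=
        mul_le_mul_of_nonneg_left key hnum
    _ = ((d : ℝ) * Real.pi) ^ 2 / 16 ^ 2 * (1 / (((k : ℝ) - 1) * k)) * (k : ℝ) ^ 2 := by ring

/-- **Far tail** (`d ≥ 20`): `Σ_j p_{2(j+d²+1)}(0) ≤ 800/5^d`, given summability of the even return series.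
[cite: HaraSladeSokal1993, Appendix A.1 pp. 28–30 and Table 4 (C₀(0,0;1/2d) = G_d, via the Bessel representation); lane certificate] -/
theorem tsum_far_le (hd : 20 ≤ d) (hs : Summable fun j => srwLaw d (2 * (j + (d ^ 2 + 1))) 0) :
    ∑' j, srwLaw d (2 * (j + (d ^ 2 + 1))) 0 ≤ 800 / 5 ^ d := by
  have hdpos : 0 < d := by omega
  have hd0 : (0 : ℝ) < d := by exact_mod_cast hdpos
  have hd2 : 1 ≤ d ^ 2 := Nat.one_le_pow _ _ hdpos
  have htel := hasSum_telescope (n := d ^ 2) hd2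
  set A : ℝ := (1 + 2 ^ d) * ((1 / 10) ^ (d - 4) * (d * Real.pi / 16) ^ 2) with hA
  have hA0 : 0 ≤ A := by positivity
  calc ∑' j, srwLaw d (2 * (j + (d ^ 2 + 1))) 0
      ≤ ∑' j, A * (1 / ((j + d ^ 2 : ℕ) : ℝ) - 1 / ((j + d ^ 2 + 1 : ℕ) : ℝ)) :=
        hs.tsum_le_tsum (fun j => srwLaw_far_term_le hd j) (htel.mul_left A).summable
    _ = A * (1 / ((d ^ 2 : ℕ) : ℝ)) := (htel.mul_left A).tsum_eq
    _ ≤ 800 / 5 ^ d := by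
        rw [hA]
        push_cast
        have hπ := Real.pi_lt_d2
        have hπ0 := Real.pi_pos
        -- (1+2^d)(1/10)^{d-4}(dπ/16)²/d² = (1+2^d)(1/10)^{d-4} π²/256 ≤ 2·2^d·10^4/10^d/25
        have h10 : ((1 : ℝ) / 10) ^ (d - 4) = 10 ^ 4 / 10 ^ d := by
          obtain ⟨e, he⟩ : ∃ e, d = e + 4 := ⟨d - 4, by omega⟩
          rw [he, Nat.add_sub_cancel, pow_add, one_div, inv_pow]
          field_simp
        have h2d : (1 : ℝ) + 2 ^ d ≤ 2 * 2 ^ d := by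
          have : (1 : ℝ) ≤ 2 ^ d := one_le_pow₀ (by norm_num)
          linarith
        have h5 : (10 : ℝ) ^ d = 2 ^ d * 5 ^ d := by rw [← mul_pow]; norm_num
        rw [h10, h5]
        have h2 : (0 : ℝ) < 2 ^ d := by positivity
        have h5' : (0 : ℝ) < 5 ^ d := by positivity
        rw [div_pow, show ((d : ℝ) * Real.pi) ^ 2 = (d : ℝ) ^ 2 * Real.pi ^ 2 by ring]
        field_simp
        have hππ : Real.pi ^ 2 ≤ 10 := by nlinarith
        have e1 := mul_le_mul_of_nonneg_right h2d (by positivity : (0 : ℝ) ≤ 10 ^ 4 * Real.pi ^ 2)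
        have e2 := mul_le_mul_of_nonneg_left hππ (by positivity : (0 : ℝ) ≤ 2 ^ d)
        nlinarith [e1, e2, h2]

/-! ### §3 The Chernoff table `c̄_m`, the head `4 ≤ m < 12` and the block `12 ≤ m ≤ d²` -/

/-- Rational majorants `c̄_m ≥ (2m)!·e^m/(4m)^m` for `3 ≤ m ≤ 12` (with `e ≤ 2.718281829`):
`8.37, 33.6, 168.31, 1012, 7086, 56726, 510822, 5110573, 56237558, 675063468`. [cite: HaraSladeSokal1993, Appendix A.1 pp. 28–30 and Table 4 (C₀(0,0;1/2d) = G_d, via the Bessel representation); lane certificate] -/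
def chernoffCoeff : ℕ → ℚ
  | 3 => 837 / 100
  | 4 => 168 / 5
  | 5 => 16831 / 100
  | 6 => 1012
  | 7 => 7086
  | 8 => 56726
  | 9 => 510822
  | 10 => 5110573
  | 11 => 56237558
  | 12 => 675063468
  | _ => 0

/-- `e ≤ 2.718281829` (Mathlib's `Real.exp_one_lt_d9`). [folklore] -/
private theorem exp_one_le_rat : Real.exp 1 ≤ (2718281829 / 1000000000 : ℝ) :=
  (Real.exp_one_lt_d9.trans (by norm_num)).le

/-- `(2m)!·e^m/(4dm)^m ≤ c̄_m/d^m` for `3 ≤ m ≤ 12`, `d ≥ 1`. [folklore] -/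
private theorem chernoff_le_coeff_div_pow (hd : 1 ≤ d) {m : ℕ} (h3 : 3 ≤ m) (h12 : m ≤ 12) :
    ((2 * m)! : ℝ) * Real.exp m / (4 * d * m : ℝ) ^ m ≤ (chernoffCoeff m : ℝ) / (d : ℝ) ^ m := by
  have hd0 : (0 : ℝ) < d := by exact_mod_cast hd
  have hm0 : (0 : ℝ) < m := by exact_mod_cast (show 0 < m by omega)
  have hexp : Real.exp m ≤ (2718281829 / 1000000000 : ℝ) ^ m := by
    rw [show (m : ℝ) = m * 1 by ring, Real.exp_nat_mul]
    exact pow_le_pow_left₀ (Real.exp_pos 1).le exp_one_le_rat m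
  have hkey : ((2 * m)! : ℝ) * Real.exp m ≤ (chernoffCoeff m : ℝ) * (4 * m : ℝ) ^ m := by
    have hmpos : (0 : ℝ) < Real.exp m := Real.exp_pos _
    interval_cases m <;> norm_num [chernoffCoeff, Nat.factorial] at hexp ⊢ <;> nlinarith [hexp, hmpos]
  have hdm : (0 : ℝ) < (d : ℝ) ^ m := by positivity
  have h4m : (0 : ℝ) < (4 * m : ℝ) ^ m := by positivity
  rw [show (4 * d * m : ℝ) ^ m = (4 * m : ℝ) ^ m * (d : ℝ) ^ m by rw [← mul_pow]; ring_nf,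
    div_le_div_iff₀ (by positivity) hdm]
  calc ((2 * m)! : ℝ) * Real.exp m * (d : ℝ) ^ m
      ≤ (chernoffCoeff m : ℝ) * (4 * m : ℝ) ^ m * (d : ℝ) ^ m := mul_le_mul_of_nonneg_right hkey hdm.le
    _ = (chernoffCoeff m : ℝ) * ((4 * m : ℝ) ^ m * (d : ℝ) ^ m) := by ring

/-- `p_{2m}(0) ≤ c̄_m/d^m` for `3 ≤ m ≤ 12`, `d ≥ 1`. [cite: HaraSladeSokal1993, Appendix A.1 pp. 28–30 and Table 4 (C₀(0,0;1/2d) = G_d, via the Bessel representation); lane certificate] -/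
theorem srwLaw_two_mul_zero_le_coeff (hd : 1 ≤ d) {m : ℕ} (h3 : 3 ≤ m) (h12 : m ≤ 12) :
    srwLaw d (2 * m) 0 ≤ (chernoffCoeff m : ℝ) / (d : ℝ) ^ m :=
  (srwLaw_two_mul_zero_le_chernoff hd m).trans (chernoff_le_coeff_div_pow hd h3 h12)

/-- `c/d^k ≤ (c/22^{k−4})/d⁴` for `d ≥ 22`, `k ≥ 4`, `c ≥ 0`. [folklore] -/
private theorem div_pow_le_div_pow_four (hd : 22 ≤ d) {k : ℕ} (hk : 4 ≤ k) {c : ℝ} (hc : 0 ≤ c) :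
    c / (d : ℝ) ^ k ≤ c / 22 ^ (k - 4) / (d : ℝ) ^ 4 := by
  have hd0 : (0 : ℝ) < d := by exact_mod_cast (show 0 < d by omega)
  have hd22 : (22 : ℝ) ≤ d := by exact_mod_cast hd
  rw [div_div]
  refine div_le_div_of_nonneg_left hc (by positivity) ?_
  obtain ⟨e, rfl⟩ : ∃ e, k = e + 4 := ⟨k - 4, by omega⟩
  rw [Nat.add_sub_cancel, pow_add, mul_comm, mul_comm ((d : ℝ) ^ e)]
  exact mul_le_mul_of_nonneg_left (pow_le_pow_left₀ (by norm_num) hd22 e) (by positivity)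

/-- **Head** (`d ≥ 22`): `Σ_{4 ≤ m < 12} p_{2m}(0) ≤ (Σ_{4 ≤ m < 12} c̄_m/22^{m−4})/d⁴`. [cite: HaraSladeSokal1993, Appendix A.1 pp. 28–30 and Table 4 (C₀(0,0;1/2d) = G_d, via the Bessel representation); lane certificate] -/
theorem sum_head_le (hd : 22 ≤ d) :
    ∑ m ∈ Ico 4 12, srwLaw d (2 * m) 0 ≤ (∑ m ∈ Ico 4 12, (chernoffCoeff m : ℝ) / 22 ^ (m - 4)) / (d : ℝ) ^ 4 := by
  rw [Finset.sum_div]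
  refine sum_le_sum fun m hm => ?_
  rw [mem_Ico] at hm
  have hc : (0 : ℝ) ≤ (chernoffCoeff m : ℝ) := by
    have : m = 4 ∨ m = 5 ∨ m = 6 ∨ m = 7 ∨ m = 8 ∨ m = 9 ∨ m = 10 ∨ m = 11 := by omega
    rcases this with rfl | rfl | rfl | rfl | rfl | rfl | rfl | rfl <;> norm_num [chernoffCoeff]
  exact (srwLaw_two_mul_zero_le_coeff (by omega) (by omega) (by omega)).trans
    (div_pow_le_div_pow_four hd hm.1 hc)

/-- **Block** (`d ≥ 22`): `Σ_{12 ≤ m ≤ d²} p_{2m}(0) ≤ (d² − 11)·p_{24}(0) ≤ (c̄₁₂/22⁶)/d⁴`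
(`m ↦ p_{2m}(0)` is antitone). [cite: HaraSladeSokal1993, Appendix A.1 pp. 28–30 and Table 4 (C₀(0,0;1/2d) = G_d, via the Bessel representation); lane certificate] -/
theorem sum_block_le (hd : 22 ≤ d) :
    ∑ m ∈ Ico 12 (d ^ 2 + 1), srwLaw d (2 * m) 0 ≤ (chernoffCoeff 12 : ℝ) / 22 ^ 6 / (d : ℝ) ^ 4 := by
  have hd1 : 1 ≤ d := by omega
  have hd0 : (0 : ℝ) < d := by exact_mod_cast (show 0 < d by omega)
  have hd22 : (22 : ℝ) ≤ d := by exact_mod_cast hd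
  have h12 : srwLaw d (2 * 12) 0 ≤ (chernoffCoeff 12 : ℝ) / (d : ℝ) ^ 12 :=
    srwLaw_two_mul_zero_le_coeff hd1 (by norm_num) le_rfl
  have hanti : ∀ m ∈ Ico 12 (d ^ 2 + 1), srwLaw d (2 * m) 0 ≤ srwLaw d (2 * 12) 0 := fun m hm =>
    srwLaw_two_mul_zero_antitone hd1 (mem_Ico.1 hm).1
  refine (sum_le_card_nsmul _ _ _ hanti).trans ?_
  rw [Nat.card_Ico, nsmul_eq_mul]
  have hcard : ((d ^ 2 + 1 - 12 : ℕ) : ℝ) ≤ (d : ℝ) ^ 2 := by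
    have : d ^ 2 + 1 - 12 ≤ d ^ 2 := by omega
    exact_mod_cast this
  have hq0 : 0 ≤ srwLaw d (2 * 12) 0 := srwLaw_nonneg _ _
  calc ((d ^ 2 + 1 - 12 : ℕ) : ℝ) * srwLaw d (2 * 12) 0
      ≤ (d : ℝ) ^ 2 * ((chernoffCoeff 12 : ℝ) / (d : ℝ) ^ 12) :=
        mul_le_mul hcard h12 hq0 (by positivity)
    _ = (chernoffCoeff 12 : ℝ) / (d : ℝ) ^ 10 := by field_simp
    _ ≤ (chernoffCoeff 12 : ℝ) / 22 ^ (10 - 4) / (d : ℝ) ^ 4 :=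
        div_pow_le_div_pow_four hd (by norm_num) (by norm_num [chernoffCoeff])
    _ = (chernoffCoeff 12 : ℝ) / 22 ^ 6 / (d : ℝ) ^ 4 := rfl

/-- `80000·d⁴ ≤ 5^d` for `d ≥ 22`. [folklore] -/
private theorem mul_pow_four_le_five_pow (hd : 22 ≤ d) : (80000 : ℝ) * (d : ℝ) ^ 4 ≤ 5 ^ d := by
  induction d, hd using Nat.le_induction with
  | base => norm_num
  | succ n hn ih =>
      have hn' : (22 : ℝ) ≤ n := by exact_mod_cast hn
      have hn0 : (0 : ℝ) ≤ n := by linarith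
      have h23 : (n : ℝ) + 1 ≤ 23 / 22 * n := by linarith
      have h1 : ((n : ℝ) + 1) ^ 4 ≤ 5 * (n : ℝ) ^ 4 :=
        calc ((n : ℝ) + 1) ^ 4 ≤ (23 / 22 * n) ^ 4 := pow_le_pow_left₀ (by positivity) h23 4
          _ = (23 / 22) ^ 4 * (n : ℝ) ^ 4 := by ring
          _ ≤ 5 * (n : ℝ) ^ 4 := mul_le_mul_of_nonneg_right (by norm_num) (by positivity)
      push_cast
      rw [show (5 : ℝ) ^ (n + 1) = 5 ^ n * 5 from pow_succ 5 n]
      nlinarith [ih, h1]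

/-- **Far tail, rounded** (`d ≥ 22`): `800/5^d ≤ (1/100)/d⁴`. [folklore] -/
private theorem far_le_div_pow_four (hd : 22 ≤ d) : (800 : ℝ) / 5 ^ d ≤ 1 / 100 / (d : ℝ) ^ 4 := by
  have hd0 : (0 : ℝ) < d := by exact_mod_cast (show 0 < d by omega)
  have h := mul_pow_four_le_five_pow hd
  rw [div_le_div_iff₀ (by positivity) (by positivity)]
  nlinarith [h]

/-- The numerical face of the tail: `Σ_{4 ≤ m < 12} c̄_m/22^{m−4} + c̄₁₂/22⁶ + 1/100 ≤ 51` (`= 50.38…`). [folklore] -/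
private theorem tail_coeff_le :
    (∑ m ∈ Ico 4 12, (chernoffCoeff m : ℝ) / 22 ^ (m - 4)) + (chernoffCoeff 12 : ℝ) / 22 ^ 6 + 1 / 100 ≤ 51 := by
  simp only [Finset.sum_Ico_eq_sum_range, Finset.sum_range_succ, Finset.sum_range_zero]
  norm_num [chernoffCoeff]

/-! ### §4 Assembly: `G_d ≤ 1 + 1/(2d) + 3/(4d²) − 3/(8d³) + p₆(0) + 51/d⁴` (`d ≥ 22`) -/

/-- **The Green function up to the sixth return probability** (`d ≥ 22`):
`G_d ≤ 1 + 1/(2d) + (3/(4d²) − 3/(8d³)) + p₆(0) + 51/d⁴` (exact `p₀, p₂, p₄`; Chernoff head `4 ≤ m < 12`, antitone block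
`12 ≤ m ≤ d²`, Gaussian far tail `m > d²`). [cite: HaraSladeSokal1993, Appendix A.1 pp. 28–30 and Table 4 (C₀(0,0;1/2d) = G_d, via the Bessel representation); lane certificate] -/
theorem srwI_one_le_sixth_add (hd : 22 ≤ d) :
    srwI d 1 0 0 ≤ 1 + 1 / (2 * (d : ℝ)) + (3 / (4 * (d : ℝ) ^ 2) - 3 / (8 * (d : ℝ) ^ 3)) +
      srwLaw d 6 0 + 51 / (d : ℝ) ^ 4 := by
  have hd1 : 1 ≤ d := by omega
  have hd3 : 3 ≤ d := by omega
  have hd0 : (0 : ℝ) < d := by exact_mod_cast (show 0 < d by omega)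
  have h := GreenCert.hasSum_srwLaw_two_mul_zero hd3
  have hsplit := h.summable.sum_add_tsum_nat_add (d ^ 2 + 1)
  rw [h.tsum_eq] at hsplit
  rw [← hsplit]
  have hs' : Summable fun j => srwLaw d (2 * (j + (d ^ 2 + 1))) 0 :=
    (summable_nat_add_iff (f := fun m => srwLaw d (2 * m) 0) (d ^ 2 + 1)).2 h.summable
  have hfar := (tsum_far_le (by omega) hs').trans (far_le_div_pow_four hd)
  have h12 : 12 ≤ d ^ 2 + 1 := by nlinarith
  rw [← sum_range_add_sum_Ico _ h12, ← sum_range_add_sum_Ico _ (show 4 ≤ 12 by norm_num)]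
  have hhead := sum_head_le hd
  have hblock := sum_block_le hd
  have hcoef := tail_coeff_le
  have h4 : ∑ m ∈ range 4, srwLaw d (2 * m) 0 = 1 + 1 / (2 * (d : ℝ)) +
      (3 / (4 * (d : ℝ) ^ 2) - 3 / (8 * (d : ℝ) ^ 3)) + srwLaw d 6 0 := by
    simp only [Finset.sum_range_succ, Finset.sum_range_zero, zero_add, mul_zero, mul_one]
    rw [show (2 * 2 : ℕ) = 4 by norm_num, show (2 * 3 : ℕ) = 6 by norm_num, srwLaw_two_zero hd1,
      srwLaw_four_zero hd1]
    simp [srwLaw_zero_apply]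
  rw [h4]
  have hd4 : (0 : ℝ) < (d : ℝ) ^ 4 := by positivity
  have htail : (∑ m ∈ Ico 4 12, (chernoffCoeff m : ℝ) / 22 ^ (m - 4)) / (d : ℝ) ^ 4 +
      (chernoffCoeff 12 : ℝ) / 22 ^ 6 / (d : ℝ) ^ 4 + 1 / 100 / (d : ℝ) ^ 4 ≤ 51 / (d : ℝ) ^ 4 := by
    rw [← add_div, ← add_div]
    exact div_le_div_of_nonneg_right hcoef hd4.le
  linarith

/-! ### §5 The unconditional (Chernoff-`p₆`) enclosure and its renewal floors (`d ≥ 22`) -/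

/-- `p₆(0) ≤ 8.37/d³` (Chernoff at `m = 3`; the exact value is `15/(8d³) − 45/(16d⁴) + 5/(4d⁵)`,
`SAWLoopErasureKestenRenewalThird.srwLaw_six_zero`). [cite: HaraSladeSokal1993, Appendix A.1 pp. 28–30 and Table 4 (C₀(0,0;1/2d) = G_d, via the Bessel representation); lane certificate] -/
theorem srwLaw_six_zero_le (hd : 1 ≤ d) : srwLaw d 6 0 ≤ (837 / 100 : ℝ) / (d : ℝ) ^ 3 := by
  have h := srwLaw_two_mul_zero_le_coeff hd (m := 3) le_rfl (by norm_num)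
  norm_num [chernoffCoeff] at h
  exact h

/-- **Unconditional Green-function enclosure** (`d ≥ 22`): `G_d ≤ 1 + 1/(2d) + 3/(4d²) + 8/d³ + 51/d⁴`. [cite: HaraSladeSokal1993, Appendix A.1 pp. 28–30 and Table 4 (C₀(0,0;1/2d) = G_d, via the Bessel representation); lane certificate] -/
theorem srwI_one_le_chernoff₃ (hd : 22 ≤ d) :
    srwI d 1 0 0 ≤ 1 + 1 / (2 * (d : ℝ)) + 3 / (4 * (d : ℝ) ^ 2) + 8 / (d : ℝ) ^ 3 + 51 / (d : ℝ) ^ 4 := by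
  have hd0 : (0 : ℝ) < d := by exact_mod_cast (show 0 < d by omega)
  have h1 := srwI_one_le_sixth_add hd
  have h2 := srwLaw_six_zero_le (d := d) (by omega)
  have hd3 : (0 : ℝ) < (d : ℝ) ^ 3 := by positivity
  have h3 : (837 / 100 : ℝ) / (d : ℝ) ^ 3 - 3 / (8 * (d : ℝ) ^ 3) ≤ 8 / (d : ℝ) ^ 3 := by
    rw [div_mul_eq_div_div, ← sub_div]
    exact div_le_div_of_nonneg_right (by norm_num) hd3.le
  linarith

/-- Floor algebra: `P·(2B − 1) ≤ 2dB` with `B ≥ 1` gives `P ≤ 2d/(2 − 1/B)`. [cite: HaraSladeSokal1993, §2.2 eq. (2.32) (the (0,1) bound) and Table 2 ((0,1) row); lane certificate] -/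
theorem le_renewal_floor_of {x B P : ℝ} (hB : 1 ≤ B) (h : P * (2 * B - 1) ≤ 2 * x * B) :
    P ≤ 2 * x / (2 - 1 / B) := by
  have hB0 : 0 < B := by linarith
  have h2B : 0 < 2 * B - 1 := by linarith
  have : 2 - 1 / B = (2 * B - 1) / B := by field_simp
  rw [this, div_div_eq_mul_div, le_div_iff₀ h2B]
  linarith

/-- **Unconditional renewal floor** (`d ≥ 22`): `2d − 1 − 1/(2d) − 14/d² − 120/d³ ≤ μ(ℤ^d)`. [cite: HaraSladeSokal1993, §2.2 eq. (2.32) (the (0,1) bound) and Table 2 ((0,1) row); lane certificate] -/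
theorem kesten_renewal_chernoff₃ (hd : 22 ≤ d) :
    2 * (d : ℝ) - 1 - 1 / (2 * (d : ℝ)) - 14 / (d : ℝ) ^ 2 - 120 / (d : ℝ) ^ 3 ≤ connectiveConstant d := by
  have hd0 : (0 : ℝ) < d := by exact_mod_cast (show 0 < d by omega)
  refine le_trans ?_ (two_mul_div_renewal_le_connectiveConstant_of_le (by omega) (srwI_one_le_chernoff₃ hd))
  have hB : (1 : ℝ) ≤ 1 + 1 / (2 * (d : ℝ)) + 3 / (4 * (d : ℝ) ^ 2) + 8 / (d : ℝ) ^ 3 + 51 / (d : ℝ) ^ 4 := by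
    have : (0 : ℝ) ≤ 1 / (2 * (d : ℝ)) + 3 / (4 * (d : ℝ) ^ 2) + 8 / (d : ℝ) ^ 3 + 51 / (d : ℝ) ^ 4 := by
      positivity
    linarith
  refine le_renewal_floor_of hB ?_
  rw [← sub_nonneg]
  have key : 2 * (d : ℝ) * (1 + 1 / (2 * (d : ℝ)) + 3 / (4 * (d : ℝ) ^ 2) + 8 / (d : ℝ) ^ 3 + 51 / (d : ℝ) ^ 4) -
      (2 * (d : ℝ) - 1 - 1 / (2 * (d : ℝ)) - 14 / (d : ℝ) ^ 2 - 120 / (d : ℝ) ^ 3) *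
        (2 * (1 + 1 / (2 * (d : ℝ)) + 3 / (4 * (d : ℝ) ^ 2) + 8 / (d : ℝ) ^ 3 + 51 / (d : ℝ) ^ 4) - 1) =
      (195 / 4 * (d : ℝ) ^ 4 + 251 * (d : ℝ) ^ 3 + 455 * (d : ℝ) ^ 2 + 3348 * d + 12240) / (d : ℝ) ^ 7 := by
    field_simp
    ring
  rw [key]
  positivity

/-- **Unconditional envelope floor** (`d ≥ 22`): `2d − 1 − 1/(2d) − 20/d² ≤ μ(ℤ^d)`. [cite: HaraSladeSokal1993, §2.2 eq. (2.32) (the (0,1) bound) and Table 2 ((0,1) row); lane certificate] -/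
theorem twoTerm_sub_twenty_div_sq_le_connectiveConstant_of_le (hd : 22 ≤ d) :
    2 * (d : ℝ) - 1 - 1 / (2 * (d : ℝ)) - 20 / (d : ℝ) ^ 2 ≤ connectiveConstant d := by
  have hd0 : (0 : ℝ) < d := by exact_mod_cast (show 0 < d by omega)
  have hd22 : (22 : ℝ) ≤ d := by exact_mod_cast hd
  have h := kesten_renewal_chernoff₃ hd
  have h6 : (120 : ℝ) / (d : ℝ) ^ 3 ≤ 6 / (d : ℝ) ^ 2 := by
    rw [div_le_div_iff₀ (by positivity) (by positivity)]
    nlinarith [pow_pos hd0 2]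
  have h20 : (20 : ℝ) / (d : ℝ) ^ 2 = 14 / (d : ℝ) ^ 2 + 6 / (d : ℝ) ^ 2 := by ring
  linarith

end GreenChernoff

/-! ### §6 All dimensions: `|μ(ℤ^d) − (2d − 1 − 1/(2d))| ≤ 20/d²` (`d ≥ 2`) -/

/-- **Threshold-free lower envelope**: `2d − 1 − 1/(2d) − 20/d² ≤ μ(ℤ^d)` for every `d ≥ 2` (`d ≥ 22`: §5; `3 ≤ d ≤ 21`: the
certified floors `renewalFloor_le_connectiveConstant`; `d = 2`: the floor is `−9/4 < 0 < μ(ℤ²)`).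
[cite: HaraSladeSokal1993, §2.2 eq. (2.32) (the (0,1) bound) and Table 2 ((0,1) row); lane certificate] -/
theorem twoTerm_sub_twenty_div_sq_le_connectiveConstant (hd : 2 ≤ d) :
    2 * (d : ℝ) - 1 - 1 / (2 * (d : ℝ)) - 20 / (d : ℝ) ^ 2 ≤ connectiveConstant d := by
  rcases Nat.lt_or_ge d 22 with hlt | hge
  · rcases Nat.lt_or_ge d 3 with h3 | h3
    · interval_cases d
      have h := connectiveConstant_pos 2
      norm_num at h ⊢
      linarith
    · have hle : d ≤ 21 := by omega
      refine le_trans ?_ (renewalFloor_le_connectiveConstant h3 hle)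
      interval_cases d <;> norm_num [renewalFloor]
  · exact GreenChernoff.twoTerm_sub_twenty_div_sq_le_connectiveConstant_of_le hge

/-- **The Kesten envelope with constant 20, for every `d ≥ 2`**: `|μ(ℤ^d) − (2d − 1 − 1/(2d))| ≤ 20/d²`
(upper side: the memory-six ceiling `connectiveConstant_lt_twoTerm`).  The tree's `abs_connectiveConstant_sub_two_le_all` has
`4559/d²`. [cite: HaraSladeSokal1993, §2.2 eq. (2.32) (the (0,1) bound) and Table 2 ((0,1) row); lane certificate] -/
theorem abs_connectiveConstant_sub_twoTerm_le_twenty_div_sq (hd : 2 ≤ d) :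
    |connectiveConstant d - (2 * d - 1 - 1 / (2 * (d : ℝ)))| ≤ 20 / (d : ℝ) ^ 2 := by
  have h1 := twoTerm_sub_twenty_div_sq_le_connectiveConstant hd
  have h2 := connectiveConstant_lt_twoTerm hd
  have h0 : (0 : ℝ) ≤ 20 / (d : ℝ) ^ 2 := by positivity
  rw [abs_le]
  constructor <;> linarith

end Literature.Probability.RandomPlanarGeometry.SAW.Zd.LoopErasure
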